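import Summits.HubbardSuperconductivity.HubbardSuperconductivity.Theorems.AnisotropyChordTransferFibre3TargetsV2
import Summits.HubbardSuperconductivity.HubbardSuperconductivity.Theorems.AnisotropyChordTransferFibre3MinAttained
import Summits.HubbardSuperconductivity.HubbardSuperconductivity.Theorems.AnisotropyChordTransferFibre3Krein

/-!
# Route `AnisotropyChord` / H0 rotor rung: PORT N30-A revised targets — `CertLogicV2` PROVED; forward half of `KreinThreeV2`

For the revised statement layer `…TransferFibre3TargetsV2` (theory seat `hubbard-h0-rotor-theory-1`, cycle 20, memo
ROTOR-THEORY-20 §279):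
* **`certLogicV2_holds : CertLogicV2 L Δ`** for every `L`, `Δ` — pure logic on top of `sectorMinAttained_holds`: the lowest
  symmetric `K₁` level `E = ε₁ + T₀` (a Dirichlet eigenvalue); if `T₀ ≤ T*` then `𝒩(T₀)` is invertible (`NInvertibleBelow`),
  `Φ(T₀) = T₀` (`KreinThreeV2`), and antitonicity gives `Φ(T*) ≤ Φ(T₀) = T₀ ≤ T*`, contradicting `T* < Φ(T*)`;
* **`phi_eq_of_eigenvalue`** (`L ≥ 4`, `Δ ≠ 0`): for every `T < 2ε₁` with `𝒩(T)` invertible, an eigenvalue `ε₁ + T` of the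
  symmetric hard-core `K₁` sector is a fixed point, `Φ(T) = T` — the forward implication of `KreinThreeV2`, now also for
  `T ≤ 0` (same Krein algebra as `kreinForward_holds`).
Prover seat `hubbard-h0-rotor-p1` g21; helper for stmt-HubbardSuperconductivity-19089 (`--supports`).
-/

set_option linter.dupNamespace false
set_option autoImplicit false

noncomputable section

open scoped BigOperators
open Complex Matrix

namespace Summit.HubbardSuperconductivity.HubbardSuperconductivity.Theorems.AnisotropyChord.Transfer.Fibre3

variable (L : ℕ) [NeZero L]

/-- **`CertLogicV2` holds** (revised PORT SPEC N30-A certificate logic, memo 20 §279(c)). [folklore] -/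
theorem certLogicV2_holds (Δ : ℝ) : CertLogicV2 L Δ := by
  intro Tstar _ hT2 hK hAnti hInv hPhi hG F hF
  obtain ⟨G, hGadm, hGle⟩ := hG
  obtain ⟨E, hEeig, hEmin⟩ := sectorMinAttained_holds L (K1 L) Δ F hF
  have hT : Tstar < E - eps1 L := by
    by_contra h
    rw [not_lt] at h
    have hlt2 : E - eps1 L < 2 * eps1 L := lt_of_le_of_lt h hT2
    have hdet : (Nmat L (E - eps1 L) Δ).det ≠ 0 := hInv (E - eps1 L) h
    have hfix : Phi L (E - eps1 L) Δ = E - eps1 L := by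
      apply (hK (E - eps1 L) hlt2 hdet).1
      have e : eps1 L + (E - eps1 L) = E := by ring
      rw [e]; exact hEeig
    have hanti : Phi L Tstar Δ ≤ Phi L (E - eps1 L) Δ :=
      hAnti (E - eps1 L) Tstar h hT2 (fun T hT => hInv T hT.2)
    linarith
  refine ⟨G, hGadm, ?_⟩
  have := hEmin F hF
  linarith

/-- **forward half of `KreinThreeV2`:** an eigenvalue `ε₁ + T` (`T < 2ε₁`, `𝒩(T)` invertible) is a fixed point of `Φ`.
[folklore] -/
theorem phi_eq_of_eigenvalue (hL : 4 ≤ L) {Δ : ℝ} (hΔ : Δ ≠ 0) {T : ℝ} (hT2 : T < 2 * eps1 L)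
    (hdet : (Nmat L T Δ).det ≠ 0) (hE : IsSectorEigenvalue L (K1 L) Δ (eps1 L + T)) : Phi L T Δ = T := by
  classical
  have hL2 : 2 ≤ L := by omega
  obtain ⟨Ψ, ⟨hsym, hD, hne⟩, heig⟩ := hE
  set E : ℝ := eps1 L + T with hE_def
  -- the charge
  set ρ : Cfg L → ℂ := fun d => H0apply L (K1 L) Ψ d - ((eps1 L + T : ℝ) : ℂ) * Ψ d with hρ_def
  have hρ_off : ∀ c, InD L c = false → ρ c = (Δ : ℂ) * (Wcount L c : ℂ) * Ψ c := by
    intro c hc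
    have h := heig c hc
    unfold Happly at h
    simp only [hρ_def]
    rw [← hE_def]
    linear_combination h
  have hρ_zero : ∀ c, InD L c = false → InS L c = false → ρ c = 0 := by
    intro c hDc hSc
    rw [hρ_off c hDc, Wcount_eq_zero L hDc hSc]; simp
  -- pole decomposition
  set V2 : ℂ := ((L : ℂ) ^ 2) ^ 2 with hV2
  have hV2ne : V2 ≠ 0 := by
    have : (L : ℂ) ≠ 0 := by exact_mod_cast (NeZero.ne L)
    rw [hV2]; positivity
  set β : ℂ := ip L (vfun L) Ψ / (3 * V2) with hβ_def
  have hG : ∀ c, Gapply L T ρ c = Ψ c - β * vfun L c := by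
    intro c
    rw [hρ_def, Gapply_H0E L hL hT2 Ψ c, PiPole_symm L hL2 hsym c]
  have hvρ : ip L (vfun L) ρ = -(T : ℂ) * ip L (vfun L) Ψ := by
    have h1 : ip L (vfun L) ρ = ip L (vfun L) (H0apply L (K1 L) Ψ) - ((eps1 L + T : ℝ) : ℂ) * ip L (vfun L) Ψ := by
      unfold ip; rw [Finset.mul_sum, ← Finset.sum_sub_distrib]
      refine Finset.sum_congr rfl fun d _ => ?_
      simp only [hρ_def]; ring
    rw [h1, ip_vfun_H0apply L hL2]
    push_cast; ring
  -- Φ = T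
  unfold Phi
  have hunit : IsUnit (Nmat L T Δ).det := isUnit_iff_ne_zero.mpr hdet
  -- invertible case: β ≠ 0
  have hβ : β ≠ 0 := by
    intro hβ0
    have hGΨ : ∀ c, Gapply L T ρ c = Ψ c := by intro c; rw [hG c, hβ0]; ring
    -- ρ restricted to D ⊕ S is a null vector of 𝒩
    set z : DS L → ℂ := fun i => ρ (cfgOf L i) with hz
    have hNz : Nmat L T Δ *ᵥ z = 0 := by
      funext i
      cases i with
      | inl d =>
        rw [Nmat_mulVec_inl, Pi.zero_apply]
        simp only [hz]
        rw [sum_Gentry_DS L T ρ hρ_zero, hGΨ]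
        have := hD d.1 d.2
        exact this
      | inr s =>
        rw [Nmat_mulVec_inr, Pi.zero_apply]
        have e1 : ∑ j : DS L, Gentry L T s.1 (cfgOf L j) * z j = Gapply L T ρ s.1 := by
          simp only [hz]; exact sum_Gentry_DS L T ρ hρ_zero s.1
        rw [e1, hGΨ]
        simp only [hz, cfgOf]
        have hSD : InD L s.1 = false := by
          have h := s.2; unfold InS at h
          simp only [Bool.and_eq_true, Bool.not_eq_true'] at h; exact h.1
        rw [hρ_off s.1 hSD]
        have hW : (Wcount L s.1 : ℝ) ≠ 0 := by
          have := Wcount_pos_of_InS L s.2; exact_mod_cast (by omega : Wcount L s.1 ≠ 0)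
        have hW' : (Wcount L s.1 : ℂ) ≠ 0 := by exact_mod_cast (show (Wcount L s.1 : ℝ) ≠ 0 from hW)
        have hΔ' : (Δ : ℂ) ≠ 0 := by exact_mod_cast hΔ
        push_cast
        field_simp
        ring
    have hz0 : z ≠ 0 := by
      intro hz0
      apply hne
      funext c
      have hρ0 : ρ = 0 := by
        funext c'
        by_cases hD' : InD L c' = true
        · have := congrFun hz0 (Sum.inl ⟨c', hD'⟩); simpa [hz, cfgOf] using this
        · by_cases hS' : InS L c' = true
          · have := congrFun hz0 (Sum.inr ⟨c', hS'⟩); simpa [hz, cfgOf] using this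
          · exact hρ_zero c' (by simpa using hD') (by simpa using hS')
      rw [← hGΨ c, hρ0]
      unfold Gapply; simp
    have hdet : (Nmat L T Δ).det = 0 := Matrix.exists_mulVec_eq_zero_iff.mp ⟨z, hz0, hNz⟩
    rw [hdet] at hunit
    exact not_isUnit_zero hunit
  -- the Krein vector x = −ρ/β solves 𝒩 x = v
  set x : DS L → ℂ := fun i => -ρ (cfgOf L i) / β with hx
  have hNx : Nmat L T Δ *ᵥ x = vpole L := by
    funext i
    have hsum : ∀ c, ∑ j : DS L, Gentry L T c (cfgOf L j) * x j = -(Gapply L T ρ c) / β := by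
      intro c
      simp only [hx]
      have : ∑ j : DS L, Gentry L T c (cfgOf L j) * (-ρ (cfgOf L j) / β)
          = (-1 / β) * ∑ j : DS L, Gentry L T c (cfgOf L j) * ρ (cfgOf L j) := by
        rw [Finset.mul_sum]; refine Finset.sum_congr rfl fun j _ => ?_; ring
      rw [this, sum_Gentry_DS L T ρ hρ_zero]; ring
    cases i with
    | inl d =>
      rw [Nmat_mulVec_inl, hsum, hG]
      have h0 : Ψ d.1 = 0 := hD d.1 d.2
      rw [h0]
      simp only [vpole, cfgOf, vfun]
      field_simp
      ring
    | inr s =>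
      rw [Nmat_mulVec_inr, hsum, hG]
      simp only [hx, vpole, cfgOf, vfun]
      have hSD : InD L s.1 = false := by
        have h := s.2; unfold InS at h
        simp only [Bool.and_eq_true, Bool.not_eq_true'] at h; exact h.1
      rw [hρ_off s.1 hSD]
      have hW : (Wcount L s.1 : ℂ) ≠ 0 := by
        have := Wcount_pos_of_InS L s.2
        exact_mod_cast (by omega : Wcount L s.1 ≠ 0)
      have hΔ' : (Δ : ℂ) ≠ 0 := by exact_mod_cast hΔ
      push_cast
      field_simp
      ring
  have hinv : (Nmat L T Δ)⁻¹ *ᵥ vpole L = x := by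
    rw [← hNx, Matrix.mulVec_mulVec, Matrix.nonsing_inv_mul _ hunit, Matrix.one_mulVec]
  rw [hinv]
  -- ⟨v, x⟩ = −⟨v, ρ⟩/β = 3V²T
  have hvx : star (vpole L) ⬝ᵥ x = -(1 / β) * ip L (vfun L) ρ := by
    set g : Cfg L → ℂ := fun c => -(1 / β) * ((starRingEnd ℂ) (vfun L c) * ρ c) with hg
    have hvp : ∀ i : DS L, vpole L i = vfun L (cfgOf L i) := fun i => rfl
    have hg0 : ∀ c, InD L c = false → InS L c = false → g c = 0 := by
      intro c hD' hS'; simp only [hg, hρ_zero c hD' hS', mul_zero]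
    unfold dotProduct ip
    calc ∑ i : DS L, star (vpole L) i * x i = ∑ i : DS L, g (cfgOf L i) := by
          refine Finset.sum_congr rfl fun i _ => ?_
          simp only [hg, hx, Pi.star_apply, hvp, Complex.star_def]
          ring
      _ = ∑ c : Cfg L, g c := sum_DS_eq L g hg0
      _ = -(1 / β) * ∑ c : Cfg L, (starRingEnd ℂ) (vfun L c) * ρ c := by
          simp only [hg]; rw [Finset.mul_sum]
  rw [hvx, hvρ]
  have hβ' : ip L (vfun L) Ψ = β * (3 * V2) := by rw [hβ_def]; field_simp
  rw [hβ']
  have : (-(1 / β) * (-(T : ℂ) * (β * (3 * V2)))) = ((T * (3 * ((L : ℝ) ^ 2) ^ 2) : ℝ) : ℂ) := by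
    rw [hV2]; push_cast; field_simp
  rw [this, Complex.ofReal_re]
  have hV : (0 : ℝ) < 3 * ((L : ℝ) ^ 2) ^ 2 := by
    have : (0 : ℝ) < L := by exact_mod_cast Nat.pos_of_ne_zero (NeZero.ne L)
    positivity
  rw [mul_div_assoc, div_self hV.ne', mul_one]


/-- the forward implication of `KreinThreeV2`, packaged. [folklore] -/
theorem kreinThreeV2_forward (hL : 4 ≤ L) {Δ : ℝ} (hΔ : Δ ≠ 0) (T : ℝ) (hT2 : T < 2 * eps1 L)
    (hdet : (Nmat L T Δ).det ≠ 0) : IsSectorEigenvalue L (K1 L) Δ (eps1 L + T) → Phi L T Δ = T :=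
  fun hE => phi_eq_of_eigenvalue L hL hΔ hT2 hdet hE

end Summit.HubbardSuperconductivity.HubbardSuperconductivity.Theorems.AnisotropyChord.Transfer.Fibre3

end
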